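import Literature.NumberTheory.Sieve.LinearPolynomialRoughCompositeValues
import Summits.Parity.BatemanHorn.Theorems.RoughValueTransportDefs
import HarnessLib

/-!
# Route `RoughValueTransport`, crux `BalancedSemiprimeLayer` (stmt-Parity-9469), line
# `smooth-modulus-twisted-hooley`: the registered stub `stub_linearLayer`

`--supports` file of the checked skeleton
`Summits/Parity/BatemanHorn/Cruxes/BalancedSemiprimeLayer/Lines/smooth-modulus-twisted-hooley.lean`
(crux `Summit.Parity.BatemanHorn.Theses.RoughValueTransport.BalancedSemiprimeLayer`).  It PROVES
the registered stub, verbatim: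
`stub_linearLayer : ∀ (k : ℕ) (f : Fin k → ℤ[X]), IsBatemanHornSystem f → ∀ i : Fin k,
(f i).natDegree = 1 → CoordLayerThin f i` — for a Bateman–Horn system `f` and a LINEAR coordinate
`fᵢ = aX + b`, for every `ε > 0` some `δ ∈ (0, 1/4]` makes the layer `E_{f,i}(x, δ)`
(`coordLayer f i δ x`: the `1 ≤ n ≤ x` with every `fⱼ(n) > 0` free of primes `< x^{deg fⱼ(1−δ)/2}`
and `fᵢ(n)` not prime; vocabulary file `Theorems/RoughValueTransportDefs.lean`)
`≤ ε·x/(log x)^k` eventually.  Everything used is PROVED in the tree; no definition and no new fact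
is introduced.

## The argument (sub-namespace `LinearLayer`; generic lemmas in
`Literature/NumberTheory/Sieve/LinearPolynomialRoughCompositeValues.lean`, namespace
`LinearRoughComposite`; template: the PROVED `polyPrimeCount_le_brunSieve_holds`)

1. (`coordLayer_le_card_shift`) choose `n₀` with every `fⱼ(n) ≥ 1` for `n ≥ n₀`
   (`Literature.Barriers.Parity.exists_forall_le_eval_of_leadingCoeff_pos`), translate
   `gⱼ = fⱼ(· + n₀)`, `F = ∏ⱼ gⱼ` (cost `n₀ + 1`); `gᵢ(m) = a m + b`, `a, b ≥ 1`
   (`exists_eval_comp_eq_linear`).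
2. (`card_rough_nonprime_le_sum`) for `δ ≤ 1/4` a rough non-prime value `a m + b ≥ 2` is
   composite; its least prime factor `p₁ ∣ a m + b` has `x^{(1−δ)/2} ≤ p₁ ≤ √(a x + b) ≤ x^{(1+δ)/2}`
   (eventually) and `F(m)` is free of primes `< z := ⌊x^{1/8}⌋₊ + 1` (all coordinates are
   `x^{3/8}`-rough): a union bound over the primes `p₁ ∈ (x^{(1−2δ)/2}, x^{(1+δ)/2}]`.
3. (`card_filter_dvd_and_le`, `card_apIndex_coprime_le_of_fundamentalLemma`) `p₁ ∤ a` (`p₁ > a`),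
   so these `m` form ONE class mod `p₁`, sifted by the tree's Fundamental Lemma
   `SieveSequence.fundamental_lemma_uniform_holds` on `polyAPSeq F x p₁ s` (level `z`, remainders
   `≤ z²`, legal since `p₁ ≥ z`; dimension `2∑ deg fⱼ` by
   `PolyPrimeCountBrun.hasSieveDimension_rootDensity_of_le`, as `ω_F(p) = ω_f(p) < p` —
   `hasNoFixedPrimeDivisor`, `polyRootCountMod_comp_X_add_C`): `≤ (1 + C_FL)(x/p₁)V(z) + z²`.
4. `V(z) = ∏_{p<z}(1 − ω_f(p)/p) ≤ 2C(f)·(16A₁/log x)^k` (`prod_one_sub_rootCount_le_mul_pow`: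
   Bateman–Horn partial product `→ C(f) > 0` by `exists_hasBatemanHornConst_holds`, and Mertens).
5. `∑_{p₁} 1/p₁ ≤ 7δ + 100/log x` (`sum_inv_primes_balanced_le`, from the PROVED Mertens window
   sums `MertensChebyshev.sum_inv_primes_window_le`); the error terms total `O(x^{7/8})`.
6. (`coordLayer_le_of_natDegree_eq_one`) so `E_{f,i}(x, δ) ≤ (7K₁δ + η)·x/(log x)^k` eventually
   for every `η > 0`, `K₁ = (1 + C_FL)·2C(f)·(16A₁)^k`; `stub_linearLayer` takes
   `δ = min (1/4) (ε/(2K))`, `η = ε/2`.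

No Bombieri–Vinogradov, no switching: every `p₁ ≤ x^{5/8}` is an individual modulus of a
progression of length `≥ x^{3/8}`.  The `f = (X)` instance with the sharp constant `2δ ≤ ε` is
`Theorems/BalancedSemiprimeLayer/Negative/TightAtX.lean` (`cruxConclusion_X`).

References: H. Halberstam, H.-E. Richert, *Sieve Methods* (1974), Thm 2.5, Thm 5.3;
S. L. Aletheia-Zomlefer, L. Fukshansky, S. R. Garcia, Expo. Math. 38 (2020), §3.6 (template);
the line card `Cruxes/BalancedSemiprimeLayer/Lines/smooth-modulus-twisted-hooley.md`.
-/

noncomputable section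

open Polynomial Filter Finset Asymptotics
open Literature.NumberTheory.Sieve
open scoped BigOperators Topology

namespace Summit.Parity.BatemanHorn.Cruxes.BalancedSemiprimeLayer.SmoothModulusTwistedHooley

namespace LinearLayer

open Literature.NumberTheory.Sieve.LinearRoughComposite

/-- **Splitting off `n ≤ n₀` and translating.**  For every `n₀`,
`E_{f,i}(x, δ) ≤ (n₀ + 1) + #{1 ≤ m ≤ x : every fⱼ(m + n₀) is free of primes < ⌈x^{deg fⱼ(1−δ)/2}⌉₊
and fᵢ(m + n₀) is not prime}` (`LinearRoughComposite.card_rough_le_card_shift`). [folklore] -/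
theorem coordLayer_le_card_shift {k : ℕ} (f : Fin k → ℤ[X]) (i : Fin k) (δ : ℝ) (x n₀ : ℕ) :
    coordLayer f i δ x ≤ (n₀ + 1) + #((Ioc 0 x).filter fun m : ℕ =>
      (∀ j, ∀ p ∈ range ⌈(x : ℝ) ^ (((f j).natDegree : ℝ) * (1 - δ) / 2)⌉₊, p.Prime →
          ¬ ((p : ℤ) ∣ ((f j).comp (X + C (n₀ : ℤ))).eval (m : ℤ))) ∧
        ¬ ((((f i).comp (X + C (n₀ : ℤ))).eval (m : ℤ)).toNat.Prime)) := by
  unfold coordLayer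
  exact card_rough_le_card_shift f i
    (fun j => ⌈(x : ℝ) ^ (((f j).natDegree : ℝ) * (1 - δ) / 2)⌉₊) x n₀

/-- **The linear layer at a fixed window width.**  For a Bateman–Horn system `f` and a linear
coordinate `fᵢ` there is `K = K(f) > 0` such that for every `0 < δ ≤ 1/4` and `η > 0`,
`E_{f,i}(x, δ) ≤ (K δ + η)·x/(log x)^k` for all large `x` (steps 1–6 of the module docstring;
`K = 7·(1 + C_FL)·2C(f)·(16A₁)^k`). [folklore] -/
theorem coordLayer_le_of_natDegree_eq_one {k : ℕ} {f : Fin k → ℤ[X]} (hf : IsBatemanHornSystem f)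
    {i : Fin k} (hi : (f i).natDegree = 1) :
    ∃ K : ℝ, 0 < K ∧ ∀ δ : ℝ, 0 < δ → δ ≤ 1 / 4 → ∀ η : ℝ, 0 < η →
      ∀ᶠ x : ℕ in atTop, (coordLayer f i δ x : ℝ) ≤ (K * δ + η) * (x : ℝ) / Real.log x ^ k := by
  classical
  -- sieve constants (functions of the degrees)
  set D : ℕ := ∑ j, (f j).natDegree with hD
  set κ : ℝ := 2 * (D : ℝ) with hκ
  obtain ⟨CFL, hCFL0, hFL⟩ := SieveSequence.fundamental_lemma_uniform_holds κ
    (((2 * D + 1 : ℕ) : ℝ) ^ (2 * D + 1) * Real.exp (2 * D * (9 / 2 + 6 / Real.log 2)))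
  set A₁ : ℝ := Real.exp (6 / Real.log 2) * Real.log 2 with hA₁
  have hA₁0 : 0 < A₁ := by rw [hA₁]; exact mul_pos (Real.exp_pos _) (Real.log_pos one_lt_two)
  -- the Bateman–Horn constant is positive
  obtain ⟨C₀, hC₀pos, hC₀⟩ := exists_hasBatemanHornConst_holds (ι := Fin k) hf
  have hdpos : ∀ j, 0 < (f j).natDegree := hf.natDegree_pos
  -- `n₀`: all `fⱼ(n) ≥ 1` for `n ≥ n₀`
  have hn₀i : ∀ j, ∃ N₀ : ℕ, ∀ n : ℕ, N₀ ≤ n → 1 ≤ (f j).eval (n : ℤ) := by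
    intro j
    obtain ⟨N₀, hN₀⟩ := Literature.Barriers.Parity.exists_forall_le_eval_of_leadingCoeff_pos
      (hdpos j) (hf.leadingCoeff_pos j) 1
    exact ⟨N₀, fun n hn => by exact_mod_cast hN₀ n hn⟩
  choose N₀ hN₀ using hn₀i
  set n₀ : ℕ := Finset.univ.sup N₀ with hn₀_def
  have hn₀ : ∀ j, ∀ n : ℕ, n₀ ≤ n → 1 ≤ (f j).eval (n : ℤ) := fun j n hn =>
    hN₀ j n ((Finset.le_sup (f := N₀) (mem_univ j)).trans hn)
  -- the shifted system `gⱼ = fⱼ(· + n₀)` and its product `F`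
  set g : Fin k → ℤ[X] := fun j => (f j).comp (X + C (n₀ : ℤ)) with hg
  have hgeval : ∀ j (m : ℕ), (g j).eval (m : ℤ) = (f j).eval (((m + n₀ : ℕ) : ℤ)) :=
    fun j m => by simp [hg, eval_comp]
  have hgpos : ∀ j (m : ℕ), 1 ≤ (g j).eval (m : ℤ) := fun j m => by
    rw [hgeval]; exact hn₀ j (m + n₀) (Nat.le_add_left _ _)
  set G : ℤ[X] := ∏ j, f j with hG
  set F : ℤ[X] := G.comp (X + C (n₀ : ℤ)) with hF
  have hFeval : ∀ m : ℕ, F.eval (m : ℤ) = ∏ j, (g j).eval (m : ℤ) := fun m => by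
    simp [hF, hG, hg, eval_comp, eval_prod]
  have hρF : ∀ p, polyRootCountMod ![F] p = polyRootCountMod f p := fun p => by
    rw [hF, Literature.Barriers.Parity.polyRootCountMod_comp_X_add_C, hG,
      ← PolyPrimeCountBrun.polyRootCountMod_eq_single_prod]
  have hρlt : ∀ p, p.Prime → polyRootCountMod ![F] p < p := fun p hp => by
    rw [hρF]; exact hf.hasNoFixedPrimeDivisor p hp
  have hρle : ∀ p, p.Prime → polyRootCountMod ![F] p ≤ D := fun p hp => by
    rw [hρF p, PolyPrimeCountBrun.polyRootCountMod_eq_single_prod]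
    refine (PolyPrimeCountBrun.polyRootCountMod_single_le_natDegree_of_lt hp ?_).trans ?_
    · rw [← PolyPrimeCountBrun.polyRootCountMod_eq_single_prod]
      exact hf.hasNoFixedPrimeDivisor p hp
    · rw [hD]; exact natDegree_prod_le _ _
  have hdim := PolyPrimeCountBrun.hasSieveDimension_rootDensity_of_le hρle hρlt
  have hFpos : ∀ m : ℕ, 0 < m → 0 < F.eval (m : ℤ) := fun m _ => by
    rw [hFeval]; exact prod_pos fun j _ => by linarith [hgpos j m]
  -- the linear coordinate: `gᵢ(m) = a m + b`, `a, b ≥ 1`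
  obtain ⟨a, b, ha, hb, hgi⟩ : ∃ a b : ℕ, 0 < a ∧ 0 < b ∧
      ∀ m : ℕ, (g i).eval (m : ℤ) = ((a * m + b : ℕ) : ℤ) :=
    exists_eval_comp_eq_linear hi (hf.leadingCoeff_pos i) n₀ (hgpos i 0)
  -- the constant
  set K₁ : ℝ := (1 + CFL) * (2 * C₀) * (16 * A₁) ^ k with hK₁
  have hK₁0 : 0 < K₁ := by positivity
  refine ⟨7 * K₁, by positivity, fun δ hδ0 hδ η hη => ?_⟩
  -- eventualities in `x`
  have E1 : ∀ᶠ x : ℕ in atTop, batemanHornPartial f ⌊(x : ℝ) ^ (1 / 8 : ℝ)⌋₊ ≤ 2 * C₀ := by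
    have hy : Tendsto (fun x : ℕ => ⌊(x : ℝ) ^ (1 / 8 : ℝ)⌋₊) atTop atTop :=
      tendsto_nat_floor_atTop.comp
        ((tendsto_rpow_atTop (by norm_num)).comp tendsto_natCast_atTop_atTop)
    have h2C : ∀ᶠ y : ℕ in atTop, batemanHornPartial f y < 2 * C₀ :=
      hC₀.eventually (gt_mem_nhds (by linarith))
    exact (hy.eventually h2C).mono fun x h => h.le
  have E2 : ∀ᶠ x : ℕ in atTop, (((n₀ + 1 : ℕ) : ℝ) + 4) * (x : ℝ) ^ (7 / 8 : ℝ) ≤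
      η / 2 * ((x : ℝ) / Real.log x ^ k) :=
    eventually_rpow_le_mul_div_log_pow k (by positivity) (by positivity)
  have E3 : ∀ᶠ x : ℕ in atTop, 200 * K₁ / η ≤ Real.log x :=
    (Real.tendsto_log_atTop.comp tendsto_natCast_atTop_atTop).eventually_ge_atTop _
  have E4 : ∀ᶠ x : ℕ in atTop, Real.exp 10 ≤ (x : ℝ) ^ (1 / 4 : ℝ) :=
    ((tendsto_rpow_atTop (by norm_num)).comp tendsto_natCast_atTop_atTop).eventually_ge_atTop _
  have E5 : ∀ᶠ x : ℕ in atTop, (a : ℝ) + b ≤ (x : ℝ) ^ δ :=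
    ((tendsto_rpow_atTop hδ0).comp tendsto_natCast_atTop_atTop).eventually_ge_atTop _
  filter_upwards [eventually_ge_atTop (65536 : ℕ), E1, E2, E3, E4, E5] with x hx h1 h2 h3 h4 h5
  -- basic facts about `x`
  have hx0 : (0 : ℝ) < x := by exact_mod_cast (show 0 < x by omega)
  have hx1 : (1 : ℝ) < x := by exact_mod_cast (show 1 < x by omega)
  have hxR : (65536 : ℝ) ≤ x := by exact_mod_cast hx
  have hlogx : 0 < Real.log x := Real.log_pos hx1
  have hlogx16 : 16 * Real.log 2 ≤ Real.log x := by
    have : Real.log 65536 = 16 * Real.log 2 := by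
      rw [show (65536 : ℝ) = 2 ^ 16 by norm_num, Real.log_pow]; norm_num
    rw [← this]; exact Real.log_le_log (by norm_num) hxR
  -- parameters at height `x`
  set w : ℝ := (x : ℝ) ^ (1 / 8 : ℝ) with hw
  set y₈ : ℕ := ⌊w⌋₊ with hy₈
  set z : ℝ := ((y₈ + 1 : ℕ) : ℝ) with hz
  set yr : ℝ := (x : ℝ) ^ ((1 - 2 * δ) / 2) with hyr
  set ur : ℝ := (x : ℝ) ^ ((1 + δ) / 2) with hur
  set L : ℕ := ⌊yr⌋₊ with hL
  set U : ℕ := ⌊ur⌋₊ with hU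
  set T : Fin k → ℕ := fun j => ⌈(x : ℝ) ^ (((f j).natDegree : ℝ) * (1 - δ) / 2)⌉₊ with hT
  -- powers of `x`
  have hw4 : (4 : ℝ) ≤ w := by
    have : (65536 : ℝ) ^ (1 / 8 : ℝ) = 4 := by
      rw [show (65536 : ℝ) = (4 : ℝ) ^ (8 : ℕ) by norm_num, ← Real.rpow_natCast,
        ← Real.rpow_mul (by norm_num : (0 : ℝ) ≤ 4)]
      norm_num
    rw [← this]; exact Real.rpow_le_rpow (by norm_num) hxR (by norm_num)
  have hw0 : 0 < w := by linarith
  have hx14 : (x : ℝ) ^ (1 / 4 : ℝ) = w * w := by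
    rw [hw, ← Real.rpow_add hx0]; norm_num
  have hx14w : w + 1 ≤ (x : ℝ) ^ (1 / 4 : ℝ) := by rw [hx14]; nlinarith only [hw4]
  have hyr14 : (x : ℝ) ^ (1 / 4 : ℝ) ≤ yr :=
    Real.rpow_le_rpow_of_exponent_le hx1.le (by linarith)
  have hδ14 : (x : ℝ) ^ δ ≤ (x : ℝ) ^ (1 / 4 : ℝ) :=
    Real.rpow_le_rpow_of_exponent_le hx1.le hδ
  have hur58 : ur ≤ (x : ℝ) ^ (5 / 8 : ℝ) :=
    Real.rpow_le_rpow_of_exponent_le hx1.le (by linarith)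
  have hx78 : (x : ℝ) ^ (5 / 8 : ℝ) * (x : ℝ) ^ (1 / 4 : ℝ) = (x : ℝ) ^ (7 / 8 : ℝ) := by
    rw [← Real.rpow_add hx0]; norm_num
  have hx78one : (1 : ℝ) ≤ (x : ℝ) ^ (7 / 8 : ℝ) := Real.one_le_rpow hx1.le (by norm_num)
  have hur2 : ur ^ 2 = (x : ℝ) * (x : ℝ) ^ δ := by
    rw [hur, ← Real.rpow_natCast, ← Real.rpow_mul hx0.le,
      ← Real.rpow_one_add' hx0.le (by linarith)]
    norm_num
  -- `y₈`, `z`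
  have hy₈w : (y₈ : ℝ) ≤ w := Nat.floor_le hw0.le
  have hwy₈ : w < (y₈ : ℝ) + 1 := Nat.lt_floor_add_one w
  have hy₈4 : 4 ≤ y₈ := Nat.le_floor (by exact_mod_cast hw4)
  have hy₈2 : 2 ≤ y₈ := by omega
  have hz2 : (2 : ℝ) ≤ z := by rw [hz]; exact_mod_cast (by omega : 2 ≤ y₈ + 1)
  have hzw : z ≤ w + 1 := by rw [hz]; push_cast; linarith
  have hz0 : (0 : ℝ) ≤ z := by linarith
  have hzsq : z ^ 2 ≤ 4 * (x : ℝ) ^ (1 / 4 : ℝ) := by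
    calc z ^ 2 ≤ (2 * w) ^ 2 := pow_le_pow_left₀ hz0 (by linarith only [hzw, hw4]) 2
      _ = 4 * (x : ℝ) ^ (1 / 4 : ℝ) := by rw [hx14]; ring
  have hceilz : ⌈z⌉₊ = y₈ + 1 := by rw [hz, Nat.ceil_natCast]
  -- the window
  have hLyr : (L : ℝ) ≤ yr := Nat.floor_le (by positivity)
  have hyrL : yr < (L : ℝ) + 1 := Nat.lt_floor_add_one yr
  have hUur : (U : ℝ) ≤ ur := Nat.floor_le (by positivity)
  have hurU : ur < (U : ℝ) + 1 := Nat.lt_floor_add_one ur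
  have haL : a ≤ L := by
    refine Nat.le_floor ?_
    have : (a : ℝ) ≤ (a : ℝ) + b := by simp
    linarith
  have hLT : L < T i := by
    have h : yr < (x : ℝ) ^ (((f i).natDegree : ℝ) * (1 - δ) / 2) := by
      rw [hi, Nat.cast_one, one_mul]
      exact Real.rpow_lt_rpow_of_exponent_lt hx1 (by linarith)
    have h' : (L : ℝ) < T i := lt_of_le_of_lt hLyr (lt_of_lt_of_le h (Nat.le_ceil _))
    exact Nat.cast_lt.mp h'
  have hzT : ∀ j, ⌈z⌉₊ ≤ T j := by
    intro j
    rw [hceilz]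
    have hdj : (1 : ℝ) ≤ (f j).natDegree := by exact_mod_cast hdpos j
    have hexp : (1 / 4 : ℝ) ≤ ((f j).natDegree : ℝ) * (1 - δ) / 2 := by
      nlinarith only [hdj, hδ, hδ0]
    have h : ((y₈ + 1 : ℕ) : ℝ) ≤ (x : ℝ) ^ (((f j).natDegree : ℝ) * (1 - δ) / 2) := by
      calc ((y₈ + 1 : ℕ) : ℝ) = z := hz.symm
        _ ≤ (x : ℝ) ^ (1 / 4 : ℝ) := hzw.trans hx14w
        _ ≤ _ := Real.rpow_le_rpow_of_exponent_le hx1.le hexp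
    exact Nat.cast_le.mp (h.trans (Nat.le_ceil _))
  have hUab : a * x + b < (U + 1) ^ 2 := by
    have h : ((a * x + b : ℕ) : ℝ) < (((U + 1) ^ 2 : ℕ) : ℝ) := by
      push_cast
      have hx1' : (1 : ℝ) ≤ x := hx1.le
      calc (a : ℝ) * x + b ≤ (a + b) * x := by
            nlinarith only [hx1', (Nat.cast_nonneg b : (0 : ℝ) ≤ b)]
        _ ≤ (x : ℝ) ^ δ * x := mul_le_mul_of_nonneg_right h5 hx0.le
        _ = ur ^ 2 := by rw [hur2, mul_comm]
        _ < ((U : ℝ) + 1) ^ 2 := by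
            have hur0 : 0 ≤ ur := by positivity
            nlinarith only [hurU, hur0]
    exact_mod_cast h
  -- the sieve product `V(z)`
  set V : ℝ := ∏ p ∈ Nat.primesBelow ⌈z⌉₊, (1 - (polyRootCountMod ![F] p : ℝ) / p) with hVdef
  have hV0 : 0 ≤ V := prod_nonneg fun p _ => by
    have := rootDensity_le_one F p
    rw [rootDensity_apply] at this
    linarith
  have hlogy₈ : Real.log x / 16 ≤ Real.log y₈ := by
    have hw2 : w / 2 ≤ y₈ := by linarith
    have hlogw : Real.log w = 1 / 8 * Real.log x := by rw [hw, Real.log_rpow hx0]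
    calc Real.log x / 16 ≤ Real.log (w / 2) := by
          rw [Real.log_div hw0.ne' (by norm_num), hlogw]; linarith
      _ ≤ Real.log y₈ := Real.log_le_log (by linarith) hw2
  have hlogy₈pos : 0 < Real.log y₈ := lt_of_lt_of_le (by positivity) hlogy₈
  have hVle : V ≤ 2 * C₀ * ((16 * A₁) ^ k / Real.log x ^ k) := by
    have hV1 : V ≤ 2 * C₀ * (A₁ / Real.log y₈) ^ k := by
      have := prod_one_sub_rootCount_le_mul_pow (k := k) f hρF hy₈2 (by positivity) h1
      rw [hA₁, hVdef, hz]; exact this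
    have hA2 : A₁ / Real.log y₈ ≤ 16 * A₁ / Real.log x := by
      calc A₁ / Real.log y₈ ≤ A₁ / (Real.log x / 16) :=
            div_le_div_of_nonneg_left hA₁0.le (by positivity) hlogy₈
        _ = 16 * A₁ / Real.log x := by field_simp
    refine hV1.trans ?_
    rw [← div_pow]
    exact mul_le_mul_of_nonneg_left (pow_le_pow_left₀ (by positivity) hA2 k) (by positivity)
  -- per-prime sieve bound
  set PW := (Ioc L U).filter Nat.Prime with hPW
  set Bp : ℕ → ℝ := fun p => (1 + CFL) * ((x : ℝ) / p) * V + z ^ 2 with hBp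
  have hper : ∀ p ∈ PW, (#((Ioc 0 x).filter fun m : ℕ =>
      p ∣ a * m + b ∧ (F.eval (m : ℤ)).natAbs.Coprime (primesProdBelow z)) : ℝ) ≤ Bp p := by
    intro p hp
    rw [hPW, mem_filter, mem_Ioc] at hp
    obtain ⟨⟨hLp, hpU⟩, hpp⟩ := hp
    have hpa : ¬ p ∣ a := Nat.not_dvd_of_pos_of_lt ha (lt_of_le_of_lt haL hLp)
    have hpz : z ≤ (p : ℝ) := by
      have : (L : ℝ) + 1 ≤ p := by exact_mod_cast hLp
      linarith
    have hqz : ∀ q : ℕ, q.Prime → (q : ℝ) < z → ¬ q ∣ p := by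
      intro q hq hqz hqp
      rcases (Nat.dvd_prime hpp).mp hqp with h | h
      · exact hq.one_lt.ne' h
      · rw [h] at hqz; linarith
    have hBp0 : 0 ≤ Bp p := by rw [hBp]; positivity
    refine card_filter_dvd_and_le hpp hpa x _ hBp0 fun s => ?_
    exact card_apIndex_coprime_le_of_fundamentalLemma hCFL0.le hFL hdim hFpos x hpp.pos s hz2 hqz
  -- summing over the window
  have hcardPW : (#PW : ℝ) ≤ (x : ℝ) ^ (5 / 8 : ℝ) := by
    have h : #PW ≤ U := (card_filter_le _ _).trans (by rw [Nat.card_Ioc]; exact Nat.sub_le U L)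
    have h' : (#PW : ℝ) ≤ U := by exact_mod_cast h
    exact h'.trans (hUur.trans hur58)
  have hsum1 : ∑ p ∈ PW, (1 : ℝ) / p ≤ 7 * δ + 100 / Real.log x :=
    sum_inv_primes_balanced_le hδ0 hδ hx1 (h4.trans hyr14)
  have hsumB : ∑ p ∈ PW, Bp p =
      (1 + CFL) * x * V * ∑ p ∈ PW, (1 : ℝ) / p + #PW * z ^ 2 := by
    simp only [hBp]
    rw [sum_add_distrib, sum_const, nsmul_eq_mul, mul_sum]
    congr 1
    exact sum_congr rfl fun p _ => by ring
  -- the main term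
  set Xr : ℝ := (x : ℝ) / Real.log x ^ k with hXr
  have hXr0 : 0 ≤ Xr := by positivity
  have hmainV : (1 + CFL) * x * V ≤ K₁ * Xr := by
    calc (1 + CFL) * x * V ≤ (1 + CFL) * x * (2 * C₀ * ((16 * A₁) ^ k / Real.log x ^ k)) :=
          mul_le_mul_of_nonneg_left hVle (by positivity)
      _ = K₁ * Xr := by rw [hK₁, hXr]; ring
  have h100 : 100 * K₁ / Real.log x ≤ η / 2 := by
    rw [div_le_iff₀ hlogx]
    have h3' : 200 * K₁ ≤ Real.log x * η := (div_le_iff₀ hη).mp h3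
    nlinarith only [h3', hη, hlogx]
  have hBsum : ∑ p ∈ PW, Bp p ≤ 7 * K₁ * δ * Xr + η / 2 * Xr + 4 * (x : ℝ) ^ (7 / 8 : ℝ) := by
    rw [hsumB]
    have hA : (1 + CFL) * x * V * ∑ p ∈ PW, (1 : ℝ) / p ≤
        K₁ * Xr * (7 * δ + 100 / Real.log x) :=
      calc (1 + CFL) * x * V * ∑ p ∈ PW, (1 : ℝ) / p
          ≤ (1 + CFL) * x * V * (7 * δ + 100 / Real.log x) :=
            mul_le_mul_of_nonneg_left hsum1 (by positivity)
        _ ≤ K₁ * Xr * (7 * δ + 100 / Real.log x) :=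
            mul_le_mul_of_nonneg_right hmainV (by positivity)
    have hB : (#PW : ℝ) * z ^ 2 ≤ 4 * (x : ℝ) ^ (7 / 8 : ℝ) :=
      calc (#PW : ℝ) * z ^ 2 ≤ (x : ℝ) ^ (5 / 8 : ℝ) * (4 * (x : ℝ) ^ (1 / 4 : ℝ)) :=
            mul_le_mul hcardPW hzsq (by positivity) (by positivity)
        _ = 4 * (x : ℝ) ^ (7 / 8 : ℝ) := by rw [← hx78]; ring
    have hC' : K₁ * Xr * (100 / Real.log x) ≤ η / 2 * Xr := by
      have e : K₁ * Xr * (100 / Real.log x) = (100 * K₁ / Real.log x) * Xr := by ring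
      rw [e]
      exact mul_le_mul_of_nonneg_right h100 hXr0
    have hA' : K₁ * Xr * (7 * δ + 100 / Real.log x) =
        7 * K₁ * δ * Xr + K₁ * Xr * (100 / Real.log x) := by ring
    linarith only [hA, hB, hC', hA']
  have hlow : ((n₀ + 1 : ℕ) : ℝ) + 4 * (x : ℝ) ^ (7 / 8 : ℝ) ≤ η / 2 * Xr := by
    have : ((n₀ + 1 : ℕ) : ℝ) ≤ ((n₀ + 1 : ℕ) : ℝ) * (x : ℝ) ^ (7 / 8 : ℝ) :=
      le_mul_of_one_le_right (by positivity) hx78one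
    linarith only [h2, this]
  -- the chain
  have hS := coordLayer_le_card_shift f i δ x n₀
  have hC := card_rough_nonprime_le_sum g i ha hb hgi F hFeval T x L U z hLT hzT hUab
  have h12 : coordLayer f i δ x ≤ (n₀ + 1) + ∑ p ∈ PW, #((Ioc 0 x).filter fun m : ℕ =>
      p ∣ a * m + b ∧ (F.eval (m : ℤ)).natAbs.Coprime (primesProdBelow z)) :=
    hS.trans (Nat.add_le_add_left hC _)
  have hsum_le := sum_le_sum hper
  have h12R : (coordLayer f i δ x : ℝ) ≤ (((n₀ + 1) + ∑ p ∈ PW, #((Ioc 0 x).filter fun m : ℕ =>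
        p ∣ a * m + b ∧ (F.eval (m : ℤ)).natAbs.Coprime (primesProdBelow z)) : ℕ) : ℝ) := by
    exact_mod_cast h12
  rw [Nat.cast_add, Nat.cast_sum] at h12R
  have hchain : (coordLayer f i δ x : ℝ) ≤ ((n₀ + 1 : ℕ) : ℝ) + ∑ p ∈ PW, Bp p :=
    h12R.trans (add_le_add_right hsum_le (((n₀ + 1 : ℕ)) : ℝ))
  calc (coordLayer f i δ x : ℝ) ≤ ((n₀ + 1 : ℕ) : ℝ) + ∑ p ∈ PW, Bp p := hchain
    _ ≤ 7 * K₁ * δ * Xr + η * Xr := by linarith only [hBsum, hlow]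
    _ = (7 * K₁ * δ + η) * (x : ℝ) / Real.log x ^ k := by rw [hXr]; ring

end LinearLayer

/-- **stub_linearLayer** (registered stub of the skeleton
`Cruxes/BalancedSemiprimeLayer/Lines/smooth-modulus-twisted-hooley.lean`, crux stmt-Parity-9469).
Every LINEAR coordinate `fᵢ = aX + b` of a Bateman–Horn system `f` has a thin layer: for every
`ε > 0` there is `δ ∈ (0, 1/4]` with `E_{f,i}(x, δ) ≤ ε·x/(log x)^k` eventually.  By
`LinearLayer.coordLayer_le_of_natDegree_eq_one`, `E_{f,i}(x, δ) ≤ (K_f δ + η)·x/(log x)^k`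
eventually for every `0 < δ ≤ 1/4`, `η > 0`; take `δ = min (1/4) (ε/(2K_f))`, `η = ε/2`
(`δ(ε) = O_f(ε)`, consistent with the sharp `2δ ≤ ε` at `f = (X)`,
`Negative.two_mul_delta_le_of_eventually_cruxIneq_X`). [folklore] -/
theorem stub_linearLayer :
    ∀ (k : ℕ) (f : Fin k → ℤ[X]), IsBatemanHornSystem f →
      ∀ i : Fin k, (f i).natDegree = 1 → CoordLayerThin f i := by
  intro k f hf i hi ε hε
  obtain ⟨K, hK, h⟩ := LinearLayer.coordLayer_le_of_natDegree_eq_one hf hi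
  refine ⟨min (1 / 4) (ε / (2 * K)), by positivity, min_le_left _ _, ?_⟩
  set δ : ℝ := min (1 / 4) (ε / (2 * K)) with hδ_def
  have hδ0 : 0 < δ := by positivity
  have hδ : δ ≤ 1 / 4 := min_le_left _ _
  have hδε : K * δ ≤ ε / 2 := by
    have h1 : δ ≤ ε / (2 * K) := min_le_right _ _
    rw [le_div_iff₀ (by positivity)] at h1
    linarith
  filter_upwards [h δ hδ0 hδ (ε / 2) (by positivity)] with x hx
  refine hx.trans ?_
  have hX : 0 ≤ (x : ℝ) / Real.log x ^ k :=
    div_nonneg (Nat.cast_nonneg _) (pow_nonneg (Real.log_natCast_nonneg x) k)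
  calc (K * δ + ε / 2) * x / Real.log x ^ k = (K * δ + ε / 2) * (x / Real.log x ^ k) :=
        mul_div_assoc _ _ _
    _ ≤ ε * (x / Real.log x ^ k) := mul_le_mul_of_nonneg_right (by linarith) hX
    _ = ε * x / Real.log x ^ k := (mul_div_assoc _ _ _).symm

end Summit.Parity.BatemanHorn.Cruxes.BalancedSemiprimeLayer.SmoothModulusTwistedHooley
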